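import Mathlib
import HarnessLib
import Summits.HubbardSuperconductivity.HubbardSuperconductivity.Theorems.KLProgrammeKLRegimeSplitFrameDist
import Summits.HubbardSuperconductivity.HubbardSuperconductivity.Theorems.KLProgrammeKLRegimeSplitBundleV6

/-!
# Route `KLProgramme` — the Counterterm child of crux K3 (gen-3 item stmt-HubbardSuperconductivity-19825 `KLRegimeCountertermV11`):
# THE CONTRACTION STEP OF THE COUNTERTERM MAP IN `frameDist` from (E3c-G), and the scale sums of `lipBar` / `twoLegBar … 0`
# (seat hubbard-kl-k3c3-p1, part G; the contraction and tail inputs of the wholesale continuation)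

At level `n` the continuation iterates `Φ_n F := P^G(F) ⊖ D_n^G(F) = −Σ_{i ≤ n} ℓ_i^G(F)`.  (E3c-G) `FrameLipschitzG … F i` bounds each piece's
response to a comparison frame `F′` that is admissible (`FrameOK R U (nScales β) μ F′`) and carries the history `hist F′ j`, `j < i`:
`|ℓ_i^G(F)(q) − ℓ_i^G(F′)(q)| ≤ lipBar G Q U i · frameDist F F′`.  Hence (§2) `|Σ_{i ≤ n} ℓ_i^G(F)(q) − Σ_{i ≤ n} ℓ_i^G(F′)(q)| ≤
(Σ_{i ≤ n} lipBar i)·frameDist F F′` at every `q` and **`frameDist (Φ_n F) (Φ_n F′) ≤ (Σ_{i ≤ n} lipBar G Q U i) · frameDist F F′`**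
(`frameDist_counterImage_le`), with (§1) `Σ_{i < m} lipBar G Q U i ≤ (4/3)·(G.SL + Q.SL·|U|)·|U|` — a contraction for `U` small.  §3: the
tails of the order-0 majorants, `Σ_{i ∈ Ico (j+1) m} twoLegBar G Q U 0 i ≤ (16/15)·(G.S 0 + Q.S′ 0·|U|)·|U|·16^{-(j+1)}
= (32/15)·(G.S 0 + Q.S′ 0·|U|) · (|U|·Λ_j²/e₀)` (`sum_Ico_twoLegBar_zero_le`, `sum_Ico_twoLegBar_zero_le_scale`) — the `Σ_{j<i≤n} b i` of part F
against the renormalisation unit `|U|·Λ_j²/e₀` of `RenormalisedAtF`.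

Proofs only; nothing is asserted about the Hubbard model.
-/

noncomputable section

namespace Summit.HubbardSuperconductivity.HubbardSuperconductivity.Theorems.KLRegimeSplit

set_option linter.dupNamespace false -- summit = problem name (single-conjunct summit), D-0017

open Real Finset
open Literature.MathematicalPhysics.QuantumLattice Literature.Probability.LatticeModels
open Summit.HubbardSuperconductivity.HubbardSuperconductivity.Theorems.KLProgrammeLegKernels

/-! ## §1 Scale sums of the frame-Lipschitz majorant -/

/-- `lipBar G Q U i = (G.SL + Q.SL·|U|)·|U|·(1/4)^i`. -/
theorem lipBar_eq (G : GeoConsts) (Q : EngConsts) (U : ℝ) (i : ℕ) :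
    lipBar G Q U i = (G.SL + Q.SL * |U|) * |U| * (1 / 4 : ℝ) ^ i := by
  unfold lipBar
  rw [one_div, inv_pow]

/-- The geometric sum `Σ_{i<m} (1/4)^i ≤ 4/3`. -/
theorem sum_quarter_pow_le (m : ℕ) : ∑ i ∈ range m, (1 / 4 : ℝ) ^ i ≤ 4 / 3 := by
  have h := geom_sum_mul_neg (1 / 4 : ℝ) m
  have hp : 0 ≤ (1 / 4 : ℝ) ^ m := by positivity
  linarith

/-- **The frame-Lipschitz majorants sum to `(4/3)·(G.SL + Q.SL·|U|)·|U|`** (volume/β-free; `< 1` for `U` small: the contraction). -/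
theorem sum_lipBar_le (G : GeoConsts) (Q : EngConsts) (U : ℝ) (hSL : 0 ≤ G.SL + Q.SL * |U|) (m : ℕ) :
    ∑ i ∈ range m, lipBar G Q U i ≤ 4 / 3 * (G.SL + Q.SL * |U|) * |U| := by
  simp_rw [lipBar_eq]
  rw [← mul_sum]
  have hc : 0 ≤ (G.SL + Q.SL * |U|) * |U| := mul_nonneg hSL (abs_nonneg U)
  calc (G.SL + Q.SL * |U|) * |U| * ∑ i ∈ range m, (1 / 4 : ℝ) ^ i ≤ (G.SL + Q.SL * |U|) * |U| * (4 / 3) :=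
        mul_le_mul_of_nonneg_left (sum_quarter_pow_le m) hc
    _ = 4 / 3 * (G.SL + Q.SL * |U|) * |U| := by ring

/-- `0 ≤ lipBar G Q U i` when `G.SL + Q.SL·|U| ≥ 0`. -/
theorem lipBar_nonneg' {G : GeoConsts} {Q : EngConsts} {U : ℝ} (hSL : 0 ≤ G.SL + Q.SL * |U|) (i : ℕ) : 0 ≤ lipBar G Q U i := by
  rw [lipBar_eq]; positivity

/-! ## §2 The contraction step of the counterterm map in `frameDist` -/

section Model

variable (L M : ℕ) [NeZero L] [NeZero M]

/-- **The summed frame response.**  If (E3c-G) holds at the frame `F` for every scale `i ≤ n` and the comparison frame `F′` is admissible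
with the history `hist F′ j` for all `j < n`, then at every momentum
`|Σ_{i ≤ n} ℓ_i^G(F)(q) − Σ_{i ≤ n} ℓ_i^G(F′)(q)| ≤ (Σ_{i ≤ n} lipBar G Q U i) · frameDist F F′`. -/
theorem abs_sum_pieces_sub_le_of_frameLipschitz {hist : TrigPolyC4v → ℕ → Prop} {G : GeoConsts} {Q : EngConsts} {R : RenConsts}
    {β U μ : ℝ} {F F' : TrigPolyC4v} {n : ℕ} (hLip : ∀ i ≤ n, FrameLipschitzG L M hist G Q R β U μ F i)
    (hF' : FrameOK R U (klTempScaleIdx β klE0) μ F') (hhist : ∀ j < n, hist F' j) (q : Fin 2 → ℝ) :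
    |∑ i ∈ range (n + 1), (klTwoLegPieceG L M β U μ F i).eval q - ∑ i ∈ range (n + 1), (klTwoLegPieceG L M β U μ F' i).eval q| ≤
      (∑ i ∈ range (n + 1), lipBar G Q U i) * frameDist F F' := by
  rw [← sum_sub_distrib, sum_mul]
  refine (abs_sum_le_sum_abs _ _).trans (sum_le_sum fun i hi => ?_)
  have hin : i ≤ n := Nat.lt_succ_iff.mp (mem_range.mp hi)
  exact hLip i hin F' hF' (fun j hj => hhist j (lt_of_lt_of_le hj hin)) q

/-- **THE CONTRACTION STEP**: under the same hypotheses,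
`frameDist (P^G(F) ⊖ D_n^G(F)) (P^G(F′) ⊖ D_n^G(F′)) ≤ (Σ_{i ≤ n} lipBar G Q U i) · frameDist F F′`. -/
theorem frameDist_counterImage_le {hist : TrigPolyC4v → ℕ → Prop} {G : GeoConsts} {Q : EngConsts} {R : RenConsts}
    {β U μ : ℝ} {F F' : TrigPolyC4v} {n : ℕ} (hLip : ∀ i ≤ n, FrameLipschitzG L M hist G Q R β U μ F i)
    (hF' : FrameOK R U (klTempScaleIdx β klE0) μ F') (hhist : ∀ j < n, hist F' j) :
    frameDist (fsub (klFrameProjG L μ F) (klTwoLegPolyG L M β U μ F n))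
        (fsub (klFrameProjG L μ F') (klTwoLegPolyG L M β U μ F' n)) ≤
      (∑ i ∈ range (n + 1), lipBar G Q U i) * frameDist F F' :=
  frameDist_le_of_forall fun q => by
    have h := abs_sum_pieces_sub_le_of_frameLipschitz L M hLip hF' hhist q
    have e : (fsub (klFrameProjG L μ F) (klTwoLegPolyG L M β U μ F n)).eval q -
        (fsub (klFrameProjG L μ F') (klTwoLegPolyG L M β U μ F' n)).eval q =
        -(∑ i ∈ range (n + 1), (klTwoLegPieceG L M β U μ F i).eval q -
          ∑ i ∈ range (n + 1), (klTwoLegPieceG L M β U μ F' i).eval q) := by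
      rw [eval_fsub, eval_fsub, sum_eval_klTwoLegPieceG, sum_eval_klTwoLegPieceG]; ring
    rw [e, abs_neg]
    exact h

/-- **The response of the new frame's coarse pieces** (the `lip i · d` input of part F's `abs_eval_counterImage_add_partialSum_le`): with
(E3c-G) at the NEW frame `F′` for `i ≤ j` and the OLD frame `F` admissible with history below `j`,
`|ℓ_i^G(F′)(q) − ℓ_i^G(F)(q)| ≤ lipBar G Q U i · frameDist F′ F` for every `i ≤ j`. -/
theorem abs_piece_response_le {hist : TrigPolyC4v → ℕ → Prop} {G : GeoConsts} {Q : EngConsts} {R : RenConsts}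
    {β U μ : ℝ} {F F' : TrigPolyC4v} {j : ℕ} (hLip : ∀ i ≤ j, FrameLipschitzG L M hist G Q R β U μ F' i)
    (hF : FrameOK R U (klTempScaleIdx β klE0) μ F) (hhist : ∀ i < j, hist F i) :
    ∀ i ≤ j, ∀ q : Fin 2 → ℝ,
      |(klTwoLegPieceG L M β U μ F' i).eval q - (klTwoLegPieceG L M β U μ F i).eval q| ≤ lipBar G Q U i * frameDist F' F :=
  fun i hi q => hLip i hi F hF (fun i' hi' => hhist i' (lt_of_lt_of_le hi' hi)) q

end Model

/-! ## §3 Tails of the order-0 majorants against the renormalisation unit -/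

/-- `twoLegBar G Q U 0 i = (G.S 0 + Q.S′ 0·|U|)·|U|·(1/16)^i`. -/
theorem twoLegBar_zero_eq (G : GeoConsts) (Q : EngConsts) (U : ℝ) (i : ℕ) :
    twoLegBar G Q U 0 i = (G.S 0 + Q.S' 0 * |U|) * |U| * (1 / 16 : ℝ) ^ i := by
  unfold twoLegBar uPow
  simp only [↓reduceIte, Nat.cast_zero, zero_sub]
  rw [show (-2 : ℤ) * (i : ℤ) = -((2 * i : ℕ) : ℤ) by push_cast; ring, zpow_neg, zpow_natCast, pow_mul, one_div, inv_pow]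
  norm_num

/-- The geometric tail `Σ_{i ∈ Ico a m} (1/16)^i ≤ (16/15)·(1/16)^a`. -/
theorem sum_Ico_sixteenth_pow_le (a m : ℕ) : ∑ i ∈ Ico a m, (1 / 16 : ℝ) ^ i ≤ 16 / 15 * (1 / 16 : ℝ) ^ a := by
  rcases le_or_gt m a with hma | ham
  · rw [Ico_eq_empty_of_le hma, sum_empty]; positivity
  · have h := geom_sum_Ico_le_of_lt_one (x := (1 / 16 : ℝ)) (by norm_num) (by norm_num) (m := a) (n := m)
    refine h.trans ?_
    rw [div_eq_mul_inv]
    have : ((1 : ℝ) - 1 / 16)⁻¹ = 16 / 15 := by norm_num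
    rw [this, mul_comm]

/-- **Tail of the order-0 majorants**: `Σ_{i ∈ Ico (j+1) m} twoLegBar G Q U 0 i ≤ (16/15)·(G.S 0 + Q.S′ 0·|U|)·|U|·(1/16)^(j+1)`. -/
theorem sum_Ico_twoLegBar_zero_le (G : GeoConsts) (Q : EngConsts) (U : ℝ) (hS : 0 ≤ G.S 0 + Q.S' 0 * |U|) (j m : ℕ) :
    ∑ i ∈ Ico (j + 1) m, twoLegBar G Q U 0 i ≤ 16 / 15 * (G.S 0 + Q.S' 0 * |U|) * |U| * (1 / 16 : ℝ) ^ (j + 1) := by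
  simp_rw [twoLegBar_zero_eq]
  rw [← mul_sum]
  have hc : 0 ≤ (G.S 0 + Q.S' 0 * |U|) * |U| := mul_nonneg hS (abs_nonneg U)
  calc (G.S 0 + Q.S' 0 * |U|) * |U| * ∑ i ∈ Ico (j + 1) m, (1 / 16 : ℝ) ^ i
      ≤ (G.S 0 + Q.S' 0 * |U|) * |U| * (16 / 15 * (1 / 16 : ℝ) ^ (j + 1)) :=
        mul_le_mul_of_nonneg_left (sum_Ico_sixteenth_pow_le _ _) hc
    _ = 16 / 15 * (G.S 0 + Q.S' 0 * |U|) * |U| * (1 / 16 : ℝ) ^ (j + 1) := by ring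

/-- The renormalisation unit at scale `j`: `|U|·Λ_j²/e₀ = |U|·e₀·(1/16)^j` (`Λ_j = klScale klE0 j = e₀·4^{-j}`). -/
theorem renormUnit_eq (U : ℝ) (j : ℕ) : |U| * klScale klE0 j ^ 2 / klE0 = |U| * klE0 * (1 / 16 : ℝ) ^ j := by
  have he0 : (klE0 : ℝ) ≠ 0 := by norm_num [klE0]
  unfold klScale
  have h16 : (16 : ℝ) ^ j = ((4 : ℝ) ^ j) ^ 2 := by
    rw [← pow_mul, mul_comm, pow_mul]; norm_num
  rw [one_div, inv_pow, h16]
  field_simp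

/-- **Tail against the renormalisation unit**: `Σ_{i ∈ Ico (j+1) m} twoLegBar G Q U 0 i ≤ (1/(15·e₀))·(G.S 0 + Q.S′ 0·|U|)·(|U|·Λ_j²/e₀)`
(`1/(15 e₀) = 32/15`: the «≈ 2.13·S₀» of the half-tolerance budget `ctCr/2 = (5·S 0 + 1)/2`). -/
theorem sum_Ico_twoLegBar_zero_le_scale (G : GeoConsts) (Q : EngConsts) (U : ℝ) (hS : 0 ≤ G.S 0 + Q.S' 0 * |U|) (j m : ℕ) :
    ∑ i ∈ Ico (j + 1) m, twoLegBar G Q U 0 i ≤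
      1 / (15 * klE0) * (G.S 0 + Q.S' 0 * |U|) * (|U| * klScale klE0 j ^ 2 / klE0) := by
  refine (sum_Ico_twoLegBar_zero_le G Q U hS j m).trans (le_of_eq ?_)
  rw [renormUnit_eq, pow_succ]
  have he0 : (klE0 : ℝ) ≠ 0 := by norm_num [klE0]
  field_simp

end Summit.HubbardSuperconductivity.HubbardSuperconductivity.Theorems.KLRegimeSplit

end
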